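import Summits.Ventures.PercRepro.Night2FatZPlanes
import Summits.Ventures.PercRepro.Night2FatXDistOne

/-!
# night-2: the loads of the two-planes regime — the source of a distance-2 load and the cross pairs

* **`loaded_fat_target_dichotomy'`**: `loaded_fat_target_dichotomy` with the distance-2 branch exposing the two planes of
  the SOURCE: a distance-2 load at `T` carries a class line `R ⊆ (T ∖ K) ∖ {w₀, x}` with `|R| + 5 = |T ∖ K|` and two
  points `c₂', c₃' ∈ (T ∖ K) ∖ {w₀, x}` with `rk (R ∪ {c₂', c₃'}) = 4` whose planes through `R` cover `(G ∖ K) ∖ {w₀, x}`.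
* **`card_sdiff_line_le_one_of_dist_two`**: above a basis pair a distance-2 line misses at most one point of
  `Y = (T ∖ Q) ∖ {x}` and meets `Q` in at most two points.
* **`rkN_off_le_two_of_line_of_source_planes`**: in the two-planes regime (`H₀ = π₂ ∪ π₃` through `L = clF R₁`), a line
  `R ⊆ π₃` not inside `L` whose own two planes cover `H₀` forces the points of `π₂` off `L` onto a line (rank `≤ 2`).
* **`dload_eq_zero_of_cross_pair`**: in the NON-DEGENERATE two-planes regime (the points of `π₂` off `L` and those of
  `π₃` off `L` both of rank `≥ 3`) every target above `Q ∪ {x}` whose `Y` contains a point of `π₂ ∖ L` and a point of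
  `π₃ ∖ L` (a CROSS PAIR) is unloaded.
Paper `proofs/NIGHT-2-g34.md` §3.
-/

namespace PercRepro.Shadow

open PercRepro.ThmH PercRepro.PerFlat

variable {α : Type*} [DecidableEq α] {M : Matroid α} [M.Finite] {G : Finset α}

/-- **The dichotomy with the source's planes in the distance-2 branch.** -/
theorem loaded_fat_target_dichotomy' (hG : G ∈ flatsQ M (5 + 1)) (hd : (gr M \ G).card = 2)
    (hk : kColoops M G = 1) (hs : ∀ e ∈ gr M, ∀ f ∈ gr M, e ≠ f → rkN M {e, f} = 2)
    (hl : ∀ e ∈ gr M, M.Indep {e}) (hfat : (fatClosures M 5 G 2).card ≤ 1) {B₀ : Finset α}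
    (hB₀ : B₀ ∈ thinMembers M 5 G) {w₀ x : α} (hD : G \ clF M B₀ = {w₀, x}) {T : Finset α} (hTG : T ⊆ G)
    (hload : dload M 5 G (bigP M G) (dshGT2 M 5 G) T ≠ 0) :
    ∃ R ⊆ (T \ coloops M G) \ {w₀, x}, rkN M R = 2 ∧ 3 ≤ R.card ∧
      ((R.card + 4 = (T \ coloops M G).card ∧ 3 ≤ rkN M (G \ T)) ∨
        (R.card + 5 = (T \ coloops M G).card ∧ rkN M (insert w₀ (insert x R)) ≤ 3 ∧
          ∃ c₂ ∈ (T \ coloops M G) \ {w₀, x}, ∃ c₃ ∈ (T \ coloops M G) \ {w₀, x},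
            c₂ ∉ clF M R ∧ c₃ ∉ clF M (insert c₂ R) ∧
            ∀ e ∈ (G \ coloops M G) \ {w₀, x}, e ∈ clF M (insert c₂ R) ∨ e ∈ clF M (insert c₃ R))) := by
  obtain ⟨B, hB, hbig, z, hz, hloss, hcase⟩ := exists_pair_of_dload_ne_zero' hG hd hk hs hl hfat hload
  obtain ⟨hR2, hRcard⟩ := rkN_sdiff_coloops_eq_two_of_loss_ne_zero hG hd hk hs hl hB hbig hz hloss
  obtain ⟨R, hRdef⟩ : ∃ R : Finset α,
      R = (insert z B \ coloops M G) \ coloops M (insert z B \ coloops M G) := ⟨_, rfl⟩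
  rw [← hRdef] at hR2 hRcard
  have hGg : G ⊆ gr M := (mem_flatsQ.1 hG).1
  have hd' : (gr M \ G).card ≤ 5 := by omega
  have hQG : insert z B ⊆ G :=
    Finset.insert_subset (Finset.mem_sdiff.1 hz).1 (subset_G_of_mem_thinMembers hB)
  have hKB : coloops M G ⊆ B := coloops_subset_of_mem_thinMembers hG hd' hB
  have hKQ : coloops M G ⊆ insert z B := hKB.trans (Finset.subset_insert _ _)
  have hzB : z ∉ B := fun h' => (Finset.mem_sdiff.1 hz).2 (subset_clF_of_subset_gr
    ((subset_G_of_mem_thinMembers hB).trans hGg) h')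
  have hzK : z ∉ coloops M G := fun h' => hzB (hKB h')
  have hQ'6 : 6 ≤ (insert z B \ coloops M G).card := by
    have heq : insert z B \ coloops M G = insert z (B \ coloops M G) := by
      ext e
      simp only [Finset.mem_sdiff, Finset.mem_insert]
      constructor
      · rintro ⟨h' | h', h2⟩
        · exact Or.inl h'
        · exact Or.inr ⟨h', h2⟩
      · rintro (rfl | ⟨h', h2⟩)
        · exact ⟨Or.inl rfl, hzK⟩
        · exact ⟨Or.inr h', h2⟩
    rw [heq, Finset.card_insert_of_notMem (fun h' => hzB (Finset.mem_sdiff.1 h').1)]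
    omega
  have hR3 : 3 ≤ R.card := by omega
  have hRQ' : R ⊆ insert z B \ coloops M G := by
    rw [hRdef]
    exact Finset.sdiff_subset
  have hRG : R ⊆ G := hRQ'.trans (Finset.sdiff_subset.trans hQG)
  have hoff := notMem_or_notMem_insert_of_loss_ne_zero hG hd hk hs hl hB₀ hD hB hbig hz hloss
  have hRoff : ∀ u v : α, ({w₀, x} : Finset α) = {u, v} → u ∉ insert z B → u ∉ R ∧ v ∉ R := by
    intro u v huv huQ
    have huR : u ∉ R := fun h' => huQ (Finset.mem_sdiff.1 (hRQ' h')).1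
    exact ⟨huR, notMem_of_rkN_le_two_of_notMem hs hG hD hRG (by omega) hR3
      (by rw [huv]; exact Finset.pair_comm _ _) huR⟩
  have hw₀x : w₀ ∉ R ∧ x ∉ R := by
    rcases hoff with h' | h'
    · exact hRoff w₀ x rfl h'
    · exact (hRoff x w₀ (Finset.pair_comm _ _) h').symm
  have h4 := four_le_rkN_sdiff_insert_of_loss_ne_zero hG hd hk hs hl hB hbig hz hloss
  rcases hcase with ⟨-, x', hx', rfl⟩ | ⟨hno, p, hp, rfl⟩
  · obtain ⟨hx'G, hx'Q⟩ := Finset.mem_sdiff.1 (mem_goodPts.1 hx').1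
    have hx'K : x' ∉ coloops M G := fun h' => hx'Q (hKQ h')
    refine ⟨R, ?_, hR2, hR3, Or.inl ⟨?_, ?_⟩⟩
    · intro r hr
      rw [Finset.mem_sdiff, Finset.mem_insert, Finset.mem_singleton]
      refine ⟨Finset.sdiff_subset_sdiff (Finset.subset_insert _ _) (Finset.Subset.refl _) (hRQ' hr), ?_⟩
      rintro (rfl | rfl)
      · exact hw₀x.1 hr
      · exact hw₀x.2 hr
    · have heq : insert x' (insert z B) \ coloops M G = insert x' (insert z B \ coloops M G) := by
        ext e
        simp only [Finset.mem_sdiff, Finset.mem_insert]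
        constructor
        · rintro ⟨h' | h', h2⟩
          · exact Or.inl h'
          · exact Or.inr ⟨h', h2⟩
        · rintro (rfl | ⟨h', h2⟩)
          · exact ⟨Or.inl rfl, hx'K⟩
          · exact ⟨Or.inr h', h2⟩
      rw [heq, Finset.card_insert_of_notMem (fun h' => hx'Q (Finset.mem_sdiff.1 h').1)]
      omega
    · have heq : G \ insert z B = insert x' (G \ insert x' (insert z B)) := by
        ext e
        simp only [Finset.mem_sdiff, Finset.mem_insert, not_or]
        constructor
        · rintro ⟨heG, heQ⟩
          by_cases hex : e = x'
          · exact Or.inl hex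
          · exact Or.inr ⟨heG, hex, heQ⟩
        · rintro (rfl | ⟨heG, -, heQ⟩)
          · refine ⟨hx'G, ?_⟩
            rwa [Finset.mem_insert, not_or] at hx'Q
          · exact ⟨heG, heQ⟩
      rw [heq] at h4
      have := rkN_insert_le_succ (M := M) (G \ insert x' (insert z B)) x'
      omega
  · -- distance two: the source `(B, z)` has no good point
    obtain ⟨R₁, hR₁Q, hR₁2, hR₁3, hR₁card, hcop, c₂, hc₂, c₃, hc₃, hc₂R, hc₃R, hcover⟩ :=
      exists_two_planes_of_no_gtPts hG hd hk hs hl hB₀ hD hB hbig hz hloss hno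
    have hQT : insert z B ⊆ insert p.1 (insert p.2 (insert z B)) :=
      (Finset.subset_insert _ _).trans (Finset.subset_insert _ _)
    have hsub : (insert z B \ coloops M G) \ {w₀, x} ⊆
        (insert p.1 (insert p.2 (insert z B)) \ coloops M G) \ {w₀, x} :=
      Finset.sdiff_subset_sdiff (Finset.sdiff_subset_sdiff hQT (Finset.Subset.refl _)) (Finset.Subset.refl _)
    obtain ⟨⟨hp1, hp2⟩, hp12, -⟩ := mem_d2Pts.1 hp
    have hp1Q : p.1 ∉ insert z B := (Finset.mem_sdiff.1 hp1).2
    have hp2Q : p.2 ∉ insert z B := (Finset.mem_sdiff.1 hp2).2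
    have hp1K : p.1 ∉ coloops M G := fun h' => hp1Q (hKQ h')
    have hp2K : p.2 ∉ coloops M G := fun h' => hp2Q (hKQ h')
    refine ⟨R₁, hR₁Q.trans hsub, hR₁2, hR₁3, Or.inr ⟨?_, hcop, c₂, hsub hc₂, c₃, hsub hc₃, hc₂R, hc₃R, hcover⟩⟩
    have heq : insert p.1 (insert p.2 (insert z B)) \ coloops M G =
        insert p.1 (insert p.2 (insert z B \ coloops M G)) := by
      ext e
      simp only [Finset.mem_sdiff, Finset.mem_insert]
      constructor
      · rintro ⟨h' | h' | h', h2⟩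
        · exact Or.inl h'
        · exact Or.inr (Or.inl h')
        · exact Or.inr (Or.inr ⟨h', h2⟩)
      · rintro (rfl | rfl | ⟨h', h2⟩)
        · exact ⟨Or.inl rfl, hp1K⟩
        · exact ⟨Or.inr (Or.inl rfl), hp2K⟩
        · exact ⟨Or.inr (Or.inr h'), h2⟩
    rw [heq, Finset.card_insert_of_notMem, Finset.card_insert_of_notMem
      (fun h' => hp2Q (Finset.mem_sdiff.1 h').1)]
    · omega
    · rw [Finset.mem_insert, Finset.mem_sdiff]
      rintro (h' | ⟨h', -⟩)
      · exact hp12 h'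
      · exact hp1Q h'

/-- **Exchange**: `c₂ ∉ clF R` and `c₃ ∉ clF (insert c₂ R)` give `c₂ ∉ clF (insert c₃ R)`. -/
theorem notMem_clF_insert_of_notMem_clF_insert {R : Finset α} (hRg : R ⊆ gr M) {c₂ c₃ : α} (hc₂g : c₂ ∈ gr M)
    (hc₃g : c₃ ∈ gr M) (hc₂ : c₂ ∉ clF M R) (hc₃ : c₃ ∉ clF M (insert c₂ R)) : c₂ ∉ clF M (insert c₃ R) := by
  intro h'
  have h1 : rkN M (insert c₃ (insert c₂ R)) = rkN M R + 2 := by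
    rw [rkN_insert_of_notMem_clF hc₃g hc₃, rkN_insert_of_notMem_clF hc₂g hc₂]
  have hc₃' : c₃ ∉ clF M R := fun h'' => hc₃ (clF_mono (Finset.subset_insert _ _) h'')
  have h2 : rkN M (insert c₃ R) = rkN M R + 1 := rkN_insert_of_notMem_clF hc₃g hc₃'
  have heq : insert c₃ (insert c₂ R) = insert c₂ (insert c₃ R) := Finset.insert_comm _ _ _
  have h3 : rkN M (insert c₂ (insert c₃ R)) ≤ rkN M (insert c₃ R) := by
    have hsub : insert c₂ (insert c₃ R) ⊆ clF M (insert c₃ R) :=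
      Finset.insert_subset h' (subset_clF_of_subset_gr (Finset.insert_subset hc₃g hRg))
    have := rkN_mono (M := M) hsub
    rwa [rkN_clF] at this
  rw [heq] at h1
  omega

/-- **A distance-2 line above a basis pair misses at most one point of `Y = (T ∖ Q) ∖ {x}` and meets `Q` in at most
two points.** -/
theorem card_sdiff_line_le_one_of_dist_two (hG : G ∈ flatsQ M (5 + 1)) (hd : (gr M \ G).card = 2)
    (hk : kColoops M G = 1) {B : Finset α} (hB : B ∈ thinMembers M 5 G) (hnP : ¬ bigP M G B) {z : α}
    (hz : z ∈ G \ clF M B) {T : Finset α} (hT : T ∈ tgtSets M 5 G B z) {w₀ x : α} (hxT : x ∈ T)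
    (hxQ : x ∉ insert z B) {R : Finset α} (hR : R ⊆ (T \ coloops M G) \ {w₀, x}) (hR2 : rkN M R = 2)
    (hRc : R.card + 5 = (T \ coloops M G).card) :
    (((T \ insert z B).erase x) \ R).card ≤ 1 ∧ (R ∩ insert z B).card ≤ 2 := by
  have hlev := card_sdiff_coloops_eq_level_add_five hG hd hk hB hnP hz hT
  have hxTQ : x ∈ T \ insert z B := Finset.mem_sdiff.2 ⟨hxT, hxQ⟩
  have hY : ((T \ insert z B).erase x).card + 1 = (T \ insert z B).card := by
    rw [Finset.card_erase_of_mem hxTQ]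
    have : 0 < (T \ insert z B).card := Finset.card_pos.2 ⟨x, hxTQ⟩
    omega
  have hxR : x ∉ R := fun h' => (Finset.mem_sdiff.1 (hR h')).2
    (Finset.mem_insert_of_mem (Finset.mem_singleton_self _))
  have hRT : R ⊆ T \ coloops M G := fun r hr => (Finset.mem_sdiff.1 (hR hr)).1
  have hsub : R \ insert z B ⊆ ((T \ insert z B).erase x) ∩ R := by
    intro r hr
    rw [Finset.mem_sdiff] at hr
    exact Finset.mem_inter.2 ⟨Finset.mem_erase.2 ⟨fun h' => hxR (h' ▸ hr.1),
      Finset.mem_sdiff.2 ⟨(Finset.mem_sdiff.1 (hRT hr.1)).1, hr.2⟩⟩, hr.1⟩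
  have hQ5 := card_insert_sdiff_eq_five hG hd hk hB hnP hz
  have hrk5 := rkN_insert_sdiff_coloops_eq_five_of_thin hG hd hk hB hz
  have hind : M.Indep ((insert z B \ coloops M G : Finset α) : Set α) :=
    indep_of_rkN_eq_card (by rw [hrk5, hQ5])
  have hsubQ : R ∩ insert z B ⊆ insert z B \ coloops M G := by
    intro e he
    rw [Finset.mem_inter] at he
    exact Finset.mem_sdiff.2 ⟨he.2, (Finset.mem_sdiff.1 (hRT he.1)).2⟩
  have hind' : M.Indep ((R ∩ insert z B : Finset α) : Set α) := hind.subset (by exact_mod_cast hsubQ)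
  have h1 : rkN M (R ∩ insert z B) = (R ∩ insert z B).card := rkN_eq_card_of_indep hind'
  have h2 : rkN M (R ∩ insert z B) ≤ rkN M R := rkN_mono Finset.inter_subset_left
  have h3 := Finset.card_sdiff_add_card_inter R (insert z B)
  have h4 := Finset.card_le_card hsub
  have h5 := Finset.card_sdiff_add_card_inter ((T \ insert z B).erase x) R
  omega

/-- **A line of `π₃` off `L` whose own two planes cover `H₀` forces the points of `π₂` off `L` onto a line.**
Abstract form: `R₁` is the spine (rank `2`, `≥ 3` points), `π₂ = clF (insert c₂ R₁)`, `π₃ = clF (insert c₃ R₁)`;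
`R ⊆ π₃` is a rank-`2` set with a point `y₃ ∉ clF R₁`; `σ₂ = clF (insert c₂' R)`, `σ₃ = clF (insert c₃' R)` cover
`R₁` and the set `S` of points of `π₂` off `clF R₁`; then `rk S ≤ 2`. -/
theorem rkN_off_le_two_of_line_of_source_planes (hs : ∀ e ∈ gr M, ∀ f ∈ gr M, e ≠ f → rkN M {e, f} = 2)
    {R₁ : Finset α} (hR₁g : R₁ ⊆ gr M) (hR₁2 : rkN M R₁ = 2) (hR₁3 : 3 ≤ R₁.card) {c₂ c₃ : α}
    (hc₂g : c₂ ∈ gr M) (hc₃g : c₃ ∈ gr M) (hc₂ : c₂ ∉ clF M R₁) (hc₃ : c₃ ∉ clF M (insert c₂ R₁))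
    {R : Finset α} (hRg : R ⊆ gr M) (hR2 : rkN M R = 2) (hRπ : R ⊆ clF M (insert c₃ R₁)) {y₃ : α}
    (hy₃R : y₃ ∈ R) (hy₃L : y₃ ∉ clF M R₁) {c₂' c₃' : α} (hc₂'g : c₂' ∈ gr M) (hc₃'g : c₃' ∈ gr M)
    (hc₂' : c₂' ∉ clF M R) (hc₃' : c₃' ∉ clF M (insert c₂' R)) {S : Finset α}
    (hS : ∀ e ∈ S, e ∈ clF M (insert c₂ R₁) ∧ e ∉ clF M R₁)
    (hScover : ∀ e ∈ S, e ∈ clF M (insert c₂' R) ∨ e ∈ clF M (insert c₃' R))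
    (hR₁cover : ∀ e ∈ R₁, e ∈ clF M (insert c₂' R) ∨ e ∈ clF M (insert c₃' R)) : rkN M S ≤ 2 := by
  have hc₂π₃ : c₂ ∉ clF M (insert c₃ R₁) := notMem_clF_insert_of_notMem_clF_insert hR₁g hc₂g hc₃g hc₂ hc₃
  have hc₃L : c₃ ∉ clF M R₁ := fun h' => hc₃ (clF_mono (Finset.subset_insert _ _) h')
  have hπ₃ : rkN M (insert c₃ R₁) = 3 := by rw [rkN_insert_of_notMem_clF hc₃g hc₃L, hR₁2]
  have hπ₂ : rkN M (insert c₂ R₁) = 3 := by rw [rkN_insert_of_notMem_clF hc₂g hc₂, hR₁2]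
  have hπ₃g : insert c₃ R₁ ⊆ gr M := Finset.insert_subset hc₃g hR₁g
  have hπ₂g : insert c₂ R₁ ⊆ gr M := Finset.insert_subset hc₂g hR₁g
  -- `R₁ ∪ R` spans `π₃`
  have hRR₁ : R₁ ∪ R ⊆ clF M (insert c₃ R₁) :=
    Finset.union_subset ((subset_clF_of_subset_gr hR₁g).trans (clF_mono (Finset.subset_insert _ _))) hRπ
  have hrk3 : 3 ≤ rkN M (R₁ ∪ R) := by
    have h1 : rkN M (insert y₃ R₁) = 3 := by rw [rkN_insert_of_notMem_clF (hRg hy₃R) hy₃L, hR₁2]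
    have hsub : insert y₃ R₁ ⊆ R₁ ∪ R :=
      Finset.insert_subset (Finset.mem_union_right _ hy₃R) Finset.subset_union_left
    have h2 := rkN_mono (M := M) hsub
    omega
  have hclπ₃ : clF M (R₁ ∪ R) = clF M (insert c₃ R₁) :=
    clF_eq_clF_of_subset_clF_of_rkN_le hπ₃g hRR₁ (by omega)
  -- the key step for one ordering of the source's planes
  have key : ∀ u v : α, u ∈ gr M → v ∈ gr M → u ∉ clF M R → v ∉ clF M (insert u R) →
      R₁ ⊆ clF M (insert u R) → (∀ e ∈ S, e ∈ clF M (insert u R) ∨ e ∈ clF M (insert v R)) → rkN M S ≤ 2 := by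
    intro u v hug hvg hu hv hR₁σ hSc
    have hσ : rkN M (insert u R) = 3 := by rw [rkN_insert_of_notMem_clF hug hu, hR2]
    have hσg : insert u R ⊆ gr M := Finset.insert_subset hug hRg
    have hRR₁σ : R₁ ∪ R ⊆ clF M (insert u R) :=
      Finset.union_subset hR₁σ ((subset_clF_of_subset_gr hRg).trans (clF_mono (Finset.subset_insert _ _)))
    have hclσ : clF M (R₁ ∪ R) = clF M (insert u R) :=
      clF_eq_clF_of_subset_clF_of_rkN_le hσg hRR₁σ (by omega)
    -- every point of `S` lies in the other plane `τ = clF (insert v R)`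
    have hSτ : S ⊆ clF M (insert v R) := by
      intro e he
      rcases hSc e he with h' | h'
      · exfalso
        rw [← hclσ, hclπ₃] at h'
        exact (hS e he).2 (mem_clF_of_mem_two_planes hR₁g hc₂g hc₃g hc₂ hc₃ (hS e he).1 h')
      · exact h'
    have hSπ₂ : S ⊆ clF M (insert c₂ R₁) := fun e he => (hS e he).1
    have hτg : insert v R ⊆ gr M := Finset.insert_subset hvg hRg
    have hv' : v ∉ clF M R := fun h' => hv (clF_mono (Finset.subset_insert _ _) h')
    have hτ : rkN M (insert v R) = 3 := by rw [rkN_insert_of_notMem_clF hvg hv', hR2]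
    have hmod := rkN_inter_clF_add_le hτg hπ₂g
    -- `insert v R ∪ insert c₂ R₁ ⊇ insert c₂ (R₁ ∪ R)` of rank `4`
    have hc₂' : c₂ ∉ clF M (R₁ ∪ R) := by rw [hclπ₃]; exact hc₂π₃
    have hr4 : rkN M (insert c₂ (R₁ ∪ R)) = rkN M (R₁ ∪ R) + 1 := rkN_insert_of_notMem_clF hc₂g hc₂'
    have hrk3' : rkN M (R₁ ∪ R) ≤ 3 := by
      have := rkN_mono (M := M) hRR₁
      rwa [rkN_clF, hπ₃] at this
    have hsub4 : insert c₂ (R₁ ∪ R) ⊆ insert v R ∪ insert c₂ R₁ := by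
      intro e he
      rw [Finset.mem_insert, Finset.mem_union] at he
      rw [Finset.mem_union, Finset.mem_insert, Finset.mem_insert]
      rcases he with rfl | he | he
      · exact Or.inr (Or.inl rfl)
      · exact Or.inr (Or.inr he)
      · exact Or.inl (Or.inr he)
    have h4 := rkN_mono (M := M) hsub4
    have hSint : S ⊆ clF M (insert v R) ∩ clF M (insert c₂ R₁) :=
      fun e he => Finset.mem_inter.2 ⟨hSτ he, hSπ₂ he⟩
    have := rkN_mono (M := M) hSint
    omega
  -- `R₁` lies in one of the source's planes
  rcases subset_plane_of_rkN_le_two_of_cover hs hR₁g (by omega) hR₁3 hR₁cover with h2 | h3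
  · exact key c₂' c₃' hc₂'g hc₃'g hc₂' hc₃' h2 hScover
  · have hc₂'' : c₂' ∉ clF M (insert c₃' R) :=
      notMem_clF_insert_of_notMem_clF_insert hRg hc₂'g hc₃'g hc₂' hc₃'
    have hc₃'R : c₃' ∉ clF M R := fun h' => hc₃' (clF_mono (Finset.subset_insert _ _) h')
    exact key c₃' c₂' hc₃'g hc₂'g hc₃'R hc₂'' h3 (fun e he => (hScover e he).symm)

/-- **In the non-degenerate two-planes regime every target above `Q ∪ {x}` containing a CROSS PAIR is unloaded**:
a point `y₂ ∈ π₂ ∖ L` and a point `y₃ ∈ π₃ ∖ L` of `Y = (T ∖ Q) ∖ {x}`, where the points of `π₂` off `L` and those of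
`π₃` off `L` both have rank `≥ 3`.  A distance-1 line would contain both (`Y ⊆ R`), a distance-2 line misses at most
one of them, so it lies in one plane off `L` and its source's planes force the other plane's points off `L` onto a line. -/
theorem dload_eq_zero_of_cross_pair (hG : G ∈ flatsQ M (5 + 1)) (hd : (gr M \ G).card = 2)
    (hk : kColoops M G = 1) (hs : ∀ e ∈ gr M, ∀ f ∈ gr M, e ≠ f → rkN M {e, f} = 2)
    (hl : ∀ e ∈ gr M, M.Indep {e}) (hfat : (fatClosures M 5 G 2).card ≤ 1) {B₀ : Finset α}
    (hB₀ : B₀ ∈ thinMembers M 5 G) {w₀ x : α} (hD : G \ clF M B₀ = {w₀, x}) {R₁ : Finset α}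
    (hR₁V : R₁ ⊆ (G \ coloops M G) \ {w₀, x}) (hR₁2 : rkN M R₁ = 2) (hR₁3 : 3 ≤ R₁.card) {c₂ c₃ : α}
    (hc₂V : c₂ ∈ (G \ coloops M G) \ {w₀, x}) (hc₃V : c₃ ∈ (G \ coloops M G) \ {w₀, x})
    (hc₂ : c₂ ∉ clF M R₁) (hc₃ : c₃ ∉ clF M (insert c₂ R₁))
    (hcover : ∀ e ∈ (G \ coloops M G) \ {w₀, x}, e ∈ clF M (insert c₂ R₁) ∨ e ∈ clF M (insert c₃ R₁))
    (hnd₂ : 3 ≤ rkN M (((G \ coloops M G) \ {w₀, x}).filter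
      (fun e => e ∈ clF M (insert c₂ R₁) ∧ e ∉ clF M R₁)))
    (hnd₃ : 3 ≤ rkN M (((G \ coloops M G) \ {w₀, x}).filter
      (fun e => e ∈ clF M (insert c₃ R₁) ∧ e ∉ clF M R₁)))
    {B : Finset α} (hB : B ∈ thinMembers M 5 G) (hnP : ¬ bigP M G B) {z : α} (hz : z ∈ G \ clF M B)
    (hxQ : x ∉ insert z B) {T : Finset α} (hT : T ∈ tgtSets M 5 G B z) (hxT : x ∈ T) {y₂ y₃ : α}
    (hy₂ : y₂ ∈ (T \ insert z B).erase x) (hy₃ : y₃ ∈ (T \ insert z B).erase x)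
    (hy₂2 : y₂ ∈ clF M (insert c₂ R₁)) (hy₂L : y₂ ∉ clF M R₁) (hy₃3 : y₃ ∈ clF M (insert c₃ R₁))
    (hy₃L : y₃ ∉ clF M R₁) : dload M 5 G (bigP M G) (dshGT2 M 5 G) T = 0 := by
  by_contra hload
  have hGg : G ⊆ gr M := (mem_flatsQ.1 hG).1
  have hTG : T ⊆ G := subset_G_of_mem_shadowAt (mem_tgtSets.1 hT).1
  have hVg : (G \ coloops M G) \ {w₀, x} ⊆ gr M := fun e he =>
    hGg (Finset.mem_sdiff.1 (Finset.mem_sdiff.1 he).1).1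
  have hR₁g : R₁ ⊆ gr M := hR₁V.trans hVg
  have hc₂g : c₂ ∈ gr M := hVg hc₂V
  have hc₃g : c₃ ∈ gr M := hVg hc₃V
  obtain ⟨R, hR, hR2, hR3, hcase⟩ := loaded_fat_target_dichotomy' hG hd hk hs hl hfat hB₀ hD hTG hload
  have hRV : R ⊆ (G \ coloops M G) \ {w₀, x} := fun r hr =>
    Finset.sdiff_subset_sdiff (Finset.sdiff_subset_sdiff hTG (Finset.Subset.refl _)) (Finset.Subset.refl _) (hR hr)
  have hRg : R ⊆ gr M := hRV.trans hVg
  have hRcover : ∀ e ∈ R, e ∈ clF M (insert c₂ R₁) ∨ e ∈ clF M (insert c₃ R₁) := fun e he => hcover e (hRV he)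
  -- `R` cannot contain both `y₂` and `y₃`
  have hnot : ¬ (y₂ ∈ R ∧ y₃ ∈ R) := by
    rintro ⟨h2, h3⟩
    have := card_le_two_of_rkN_le_two_of_cross hs hR₁g hc₂g hc₃g hc₂ hc₃ hRg (by omega) hRcover h2 hy₂2 hy₂L
      h3 hy₃3 hy₃L
    omega
  -- the points of a plane off `L`, as finsets
  have hS₂ : ∀ e ∈ ((G \ coloops M G) \ {w₀, x}).filter (fun e => e ∈ clF M (insert c₂ R₁) ∧ e ∉ clF M R₁),
      e ∈ clF M (insert c₂ R₁) ∧ e ∉ clF M R₁ := fun e he => (Finset.mem_filter.1 he).2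
  have hS₃ : ∀ e ∈ ((G \ coloops M G) \ {w₀, x}).filter (fun e => e ∈ clF M (insert c₃ R₁) ∧ e ∉ clF M R₁),
      e ∈ clF M (insert c₃ R₁) ∧ e ∉ clF M R₁ := fun e he => (Finset.mem_filter.1 he).2
  rcases hcase with ⟨hRc, -⟩ | ⟨hRc, -, c₂', hc₂'T, c₃', hc₃'T, hc₂', hc₃', hcover'⟩
  · -- distance one: `Y ⊆ R`
    obtain ⟨hYR, -⟩ := sdiff_subset_line_of_dist_one_fat hG hd hk hB hnP hz hT hxT hxQ hR hR2 hRc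
    exact hnot ⟨hYR hy₂, hYR hy₃⟩
  · -- distance two: `R` misses at most one point of `Y`
    obtain ⟨hY1, -⟩ := card_sdiff_line_le_one_of_dist_two hG hd hk hB hnP hz hT hxT hxQ hR hR2 hRc
    have hc₂'g : c₂' ∈ gr M := hGg (hTG (Finset.mem_sdiff.1 (Finset.mem_sdiff.1 hc₂'T).1).1)
    have hc₃'g : c₃' ∈ gr M := hGg (hTG (Finset.mem_sdiff.1 (Finset.mem_sdiff.1 hc₃'T).1).1)
    have hR₁cover' : ∀ e ∈ R₁, e ∈ clF M (insert c₂' R) ∨ e ∈ clF M (insert c₃' R) :=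
      fun e he => hcover' e (hR₁V he)
    by_cases h3 : y₃ ∈ R
    · have h2 : y₂ ∉ R := fun h2 => hnot ⟨h2, h3⟩
      -- `R ⊆ π₃`
      have hRπ : R ⊆ clF M (insert c₃ R₁) := by
        rcases subset_plane_of_rkN_le_two_of_cover hs hRg (by omega) hR3 hRcover with h' | h'
        · exact absurd (mem_clF_of_mem_two_planes hR₁g hc₂g hc₃g hc₂ hc₃ (h' h3) hy₃3) hy₃L
        · exact h'
      have := rkN_off_le_two_of_line_of_source_planes hs hR₁g hR₁2 hR₁3 hc₂g hc₃g hc₂ hc₃ hRg hR2 hRπ h3 hy₃L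
        hc₂'g hc₃'g hc₂' hc₃' hS₂ (fun e he => hcover' e (Finset.mem_filter.1 he).1) hR₁cover'
      omega
    · have h2 : y₂ ∈ R := by
        by_contra h2
        have hsub : ({y₂, y₃} : Finset α) ⊆ ((T \ insert z B).erase x) \ R := by
          intro e he
          rw [Finset.mem_insert, Finset.mem_singleton] at he
          rcases he with rfl | rfl
          · exact Finset.mem_sdiff.2 ⟨hy₂, h2⟩
          · exact Finset.mem_sdiff.2 ⟨hy₃, h3⟩
        have hne : y₂ ≠ y₃ := by
          intro h'
          subst h'
          exact hy₂L (mem_clF_of_mem_two_planes hR₁g hc₂g hc₃g hc₂ hc₃ hy₂2 hy₃3)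
        have := Finset.card_le_card hsub
        rw [Finset.card_pair hne] at this
        omega
      -- `R ⊆ π₂`: the symmetric situation, with the planes swapped
      have hRπ : R ⊆ clF M (insert c₂ R₁) := by
        rcases subset_plane_of_rkN_le_two_of_cover hs hRg (by omega) hR3 hRcover with h' | h'
        · exact h'
        · exact absurd (mem_clF_of_mem_two_planes hR₁g hc₂g hc₃g hc₂ hc₃ hy₂2 (h' h2)) hy₂L
      have hc₃L : c₃ ∉ clF M R₁ := fun h' => hc₃ (clF_mono (Finset.subset_insert _ _) h')
      have hc₂π₃ : c₂ ∉ clF M (insert c₃ R₁) := notMem_clF_insert_of_notMem_clF_insert hR₁g hc₂g hc₃g hc₂ hc₃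
      have := rkN_off_le_two_of_line_of_source_planes hs hR₁g hR₁2 hR₁3 hc₃g hc₂g hc₃L hc₂π₃ hRg hR2 hRπ h2 hy₂L
        hc₂'g hc₃'g hc₂' hc₃' hS₃ (fun e he => hcover' e (Finset.mem_filter.1 he).1) hR₁cover'
      omega

end PercRepro.Shadow
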